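import Literature.Combinatorics.Designs.GoethalsSeidelArray

/-!
# The Ito-type (quasi-Williamson) array

[Balonin–Đoković, Informatsionno-upravliaiushchie sistemy 2015 (5), 2–17 = arXiv:1508.00640, §9] (`BaloninDjokovic2015`),
the cyclic case of [Schmidt, Des. Codes Cryptogr. 17 (1999)]: four CIRCULANT `±1` matrices `A, B, C, D` of order `t` are
"quasi-Williamson matrices" if

  `A Aᵀ + B Bᵀ + C Cᵀ + D Dᵀ = 4t·I`  and  `A Bᵀ + C Dᵀ = B Aᵀ + D Cᵀ`,

equivalently if the array

  `I(A,B,C,D) = [[ A,   B,   C,   D ],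
                 [-B,   A,  -D,   C ],
                 [-Cᵀ,  Dᵀ,  Aᵀ, -Bᵀ],
                 [-Dᵀ, -Cᵀ,  Bᵀ,  Aᵀ]]`

is a Hadamard matrix of order `4t` ("Ito-type Hadamard matrix"; for odd `t` these are equivalent to Ito's relative
difference sets in the dicyclic group of order `8t` and to negaperiodic Golay pairs of length `2t`, loc. cit.).  The
Williamson matrices are the special case of four symmetric circulants (then the amicability condition is automatic).
Here: the array on circulant first rows `a, b, c, d : ZMod n → ℤ` (`itoMatrix`), the block identities
(`ito_block_identity`), `I Iᵀ = m·I` from the two displayed hypotheses (`itoMatrix_mul_transpose`), and the Hadamard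
conclusion from the first-row form `Σ PAF = 0` plus amicability (`ito_isHadamard`).  This is the plug-in by which an
Ito-type quadruple of order 167 would certify a Hadamard matrix of order 668 (cell pub-namedobj, target H, family F9).
Our formalisation of the published array; `IsHadamardMatrix`, `gram`, `circT` from `GoethalsSeidelArray`.  No `sorry`.
-/

open Matrix BigOperators Finset

namespace Literature.Combinatorics.Designs.ItoArray

open Literature.Combinatorics.Designs.LegendrePairs (PAF IsPM)
open Literature.Combinatorics.Designs.GoethalsSeidel (IsHadamardMatrix gram_of_paf circT circT_apply transpose_circT
  circT_mul_circulant)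

section General

variable {G : Type*} [AddCommGroup G] [Fintype G] [DecidableEq G] {α : Type*} [CommRing α]

omit [DecidableEq G] in
/-- circulants commute (Mathlib); instance form used to orient products. [folklore] -/
private lemma cc (x y : G → α) : circulant x * circulant y = circulant y * circulant x := circulant_mul_comm x y

omit [DecidableEq G] in
/-- transposed circulants commute; instance form used to orient products. [folklore] -/
private lemma ccT (x y : G → α) : circT x * circT y = circT y * circT x := by
  rw [circT, circT, circulant_mul_comm]

/-- the sixteen blocks of the Ito-type array on circulant first rows `a, b, c, d` (`A = circulant a`, `Aᵀ = circT a`).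
[cite: BaloninDjokovic2015, §9 eq. (WillMat)] -/
def itoBlocks (a b c d : G → α) : Fin 4 → Fin 4 → Matrix G G α :=
  ![![circulant a, circulant b, circulant c, circulant d],
    ![-circulant b, circulant a, -circulant d, circulant c],
    ![-circT c, circT d, circT a, -circT b],
    ![-circT d, -circT c, circT b, circT a]]

/-- the Ito-type array as a matrix indexed by `Fin 4 × G`. [cite: BaloninDjokovic2015, §9 eq. (WillMat)] -/
def itoMatrix (a b c d : G → α) : Matrix (Fin 4 × G) (Fin 4 × G) α :=
  Matrix.of fun p q => itoBlocks a b c d p.1 q.1 p.2 q.2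

omit [DecidableEq G] in
/-- block form of `I Iᵀ`. [folklore] -/
private lemma itoMatrix_mul_transpose_apply (a b c d : G → α) (p r : Fin 4) (i k : G) :
    (itoMatrix a b c d * (itoMatrix a b c d)ᵀ) (p, i) (r, k) =
      (∑ q, itoBlocks a b c d p q * (itoBlocks a b c d r q)ᵀ) i k := by
  simp only [itoMatrix, mul_apply, transpose_apply, of_apply, Fintype.sum_prod_type, Matrix.sum_apply]

omit [DecidableEq G] in
/-- **the Ito-type block identities**: under the amicability condition `A Bᵀ + C Dᵀ = B Aᵀ + D Cᵀ` the array satisfies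
`Σ_q I_{pq} I_{rq}ᵀ = [p = r] · (A Aᵀ + B Bᵀ + C Cᵀ + D Dᵀ)` (circulants and their transposes pairwise commute).
[cite: BaloninDjokovic2015, §9 (the two equations ⇔ the array is Hadamard)] -/
theorem ito_block_identity (a b c d : G → α)
    (hab : circulant a * circT b + circulant c * circT d = circulant b * circT a + circulant d * circT c) (p r : Fin 4) :
    ∑ q, itoBlocks a b c d p q * (itoBlocks a b c d r q)ᵀ =
      if p = r then GoethalsSeidel.gram a b c d else 0 := by
  have hab' : circulant b * circT a = circulant a * circT b + circulant c * circT d - circulant d * circT c := by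
    rw [hab]; abel
  fin_cases p <;> fin_cases r <;>
    simp [itoBlocks, GoethalsSeidel.gram, Fin.sum_univ_four, Matrix.transpose_neg,
      cc c a, cc d b, cc d a, cc c b, ccT c a, ccT d b, ccT d a, ccT c b, hab'] <;>
    abel

/-- **Ito-type array: `I Iᵀ = m·I`.** If `A Aᵀ + B Bᵀ + C Cᵀ + D Dᵀ = m·I` and `A Bᵀ + C Dᵀ = B Aᵀ + D Cᵀ` for circulants
`A, B, C, D` over a finite abelian group, the Ito-type array is orthogonal with Gram constant `m`.
[cite: BaloninDjokovic2015, §9 (the two equations ⇔ the array is Hadamard)] -/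
theorem itoMatrix_mul_transpose (a b c d : G → α) (m : α) (h : GoethalsSeidel.gram a b c d = m • (1 : Matrix G G α))
    (hab : circulant a * circT b + circulant c * circT d = circulant b * circT a + circulant d * circT c) :
    itoMatrix a b c d * (itoMatrix a b c d)ᵀ = m • (1 : Matrix (Fin 4 × G) (Fin 4 × G) α) := by
  ext ⟨p, i⟩ ⟨r, k⟩
  rw [itoMatrix_mul_transpose_apply, ito_block_identity a b c d hab]
  by_cases hpr : p = r
  · subst hpr
    simp [h, Matrix.one_apply]
  · have : (p, i) ≠ (r, k) := fun e => hpr (Prod.mk.inj e).1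
    simp [hpr, this]

end General

/-! ## `±1` first rows on `ZMod n`: the Hadamard conclusion -/

section Sequences

variable {n : ℕ} [NeZero n]

omit [NeZero n] in
/-- the entries of the Ito-type array on `±1` circulants are `±1`. [cite: BaloninDjokovic2015, §9 (binary matrices)] -/
lemma itoMatrix_pm (a b c d : ZMod n → ℤ) (ha : IsPM a) (hb : IsPM b) (hc : IsPM c) (hd : IsPM d)
    (P Q : Fin 4 × ZMod n) :
    itoMatrix a b c d P Q = 1 ∨ itoMatrix a b c d P Q = -1 := by
  have hneg : ∀ x : ZMod n → ℤ, IsPM x → ∀ t, -x t = 1 ∨ -x t = -1 := fun x hx t => by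
    rcases hx t with h | h
    · right; rw [h]
    · left; rw [h]; norm_num
  obtain ⟨p, i⟩ := P
  obtain ⟨q, j⟩ := Q
  simp only [itoMatrix, of_apply]
  fin_cases p <;> fin_cases q <;>
    simp only [itoBlocks, Fin.zero_eta, Fin.mk_one, Fin.isValue, Matrix.cons_val_zero, Matrix.cons_val_one,
      Matrix.neg_apply, circulant_apply] <;>
    first
      | exact ha _ | exact hb _ | exact hc _ | exact hd _
      | exact hneg a ha _ | exact hneg b hb _ | exact hneg c hc _ | exact hneg d hd _

/-- **Ito-type (quasi-Williamson) matrices are Hadamard.** Four `±1` sequences `a, b, c, d` on `ZMod n` with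
`PAF_a(s) + PAF_b(s) + PAF_c(s) + PAF_d(s) = 0` for all `s ≠ 0` whose circulants satisfy the amicability condition
`A Bᵀ + C Dᵀ = B Aᵀ + D Cᵀ` give, through the Ito-type array, a Hadamard matrix of order `4n`.
[cite: BaloninDjokovic2015, §9 (quasi-Williamson matrices; the array is a Hadamard matrix)] -/
theorem ito_isHadamard (a b c d : ZMod n → ℤ) (ha : IsPM a) (hb : IsPM b) (hc : IsPM c) (hd : IsPM d)
    (hs : ∀ s : ZMod n, s ≠ 0 → PAF a s + PAF b s + PAF c s + PAF d s = 0)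
    (hab : circulant a * circT b + circulant c * circT d = circulant b * circT a + circulant d * circT c) :
    IsHadamardMatrix (itoMatrix a b c d) := by
  refine ⟨itoMatrix_pm a b c d ha hb hc hd, ?_⟩
  have hcard : (Fintype.card (Fin 4 × ZMod n) : ℤ) = 4 * n := by simp [Fintype.card_prod, ZMod.card]
  rw [hcard]
  exact itoMatrix_mul_transpose a b c d _ (gram_of_paf a b c d ha hb hc hd hs) hab

end Sequences

end Literature.Combinatorics.Designs.ItoArray
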